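import Summits.HodgeConjecture.CorCM.HypD3.A4LiuD3KudlaOfLineRigidity
import HarnessLib

/-!
# `hD3` line `a4-liuD3`: the place-free residual `LineRigidityS6a` ∕ `KudlaTransportedSectionEq` of the skeleton
# `Cruxes/HD3/Lines/a4_liuD3.lean` FROM the per-character line-rigidity identity S6a (B-p13's F8b-3 MAIN), BY NAME
# (cell `hodgecm-mathlib`, binder `HypD3`; crux item stmt-HodgeConjecture-24837; director g2 04:41:17Z (a))

B-p13's S6a chain (`LocalKudlaSplittingRigidity` F6, `LocalScaleModelTransport` F7/F7b, `LocalLineIsometryRigidity` F8b, with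
B-p02's F8a and B-p18's split-place `hκ`) concludes, for ONE splitting character `μ` of the CM field `F`, two hermitian lines
`⟨a₁⟩, ⟨a₂⟩`, every finite place `v` of `F⁺` and every unit `x` of `F ⊗ F⁺_v` relating the line discriminants
(`a₂⁻¹δ = x x̄ a₁⁻¹δ`), the LINE-RIGIDITY IDENTITY
«`lineTransportSplitting x (lineTransportSection a₁ ((chiLocalSplittingsD … μ a₁).s v)) = lineTransportSection a₂ ((chiLocalSplittingsD … μ a₂).s v)`»
(announced shape, 2026-08-28T04:21:47Z): B-typ01's line transport of `μ`'s `χ`-attached local splitting of record on the line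
`a₁` IS `μ`'s `χ`-attached local splitting of record on the line `a₂` (both read in the `δ/a`-models of `LocalLineModelTransport`).
This file is the GLUE from that per-character statement (hypothesis `hF8`, verbatim in the consumers' spelling) to the
family-indexed residuals of the skeleton: `lineRigidityTransported_of_perCharacter` gives the place-free residual
`LineRigidityS6a`/`LineRigidityTransported` (`∀ F dV hdV hdV0 {ι} ψ hψ aOf v i j, hS6a i j`: member `i`'s character
`μ_i := toHeckeCharacter (ψ i)` on the lines `a_i`, `a_j`), and `kudlaTransportedSectionEq_of_perCharacter` composes it with
`kudla_of_lineRigidity` (`A4LiuD3KudlaOfLineRigidity.lean`: Kudla's injectivity read on the packages of record, all places) into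
the v2/v3 residual `KudlaTransportedSectionEq` (`∀ F dV hdV hdV0 {ι} ψ hψ aOf χOf v i j, hK i j`) BYTE-FOR-BYTE, so that the
skeleton slots `stub_kudlaTransportedSectionEq := HypD3.kudlaTransportedSectionEq_of_perCharacter ‹F8b-3 MAIN›`.

HC_CM is proved only modulo the 7 printed citations (`hDel`, `h21`, `hLiu418`, `h411`, `h413`, `hD3`, `hD1''`) until rung 0 closes;
this file discharges no binder and no interface fact (pure binder bookkeeping).

## References
* [Kudla1994] S. Kudla, Israel J. Math. 87 (1994), §3 Thm. 3.1 (splitting uniqueness up to a character).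
* [Liu2021] Y. Liu, Camb. J. Math. 9 (2021) = arXiv:2102.11518, App. D Lemma D.1 (3) (l. 5233), proof l. 5249–5255.
* [MoeglinVignerasWaldspurger1987] MVW, LNM 1291, Chap. 2 II.1, Chap. 3 IV.4.
-/

set_option autoImplicit false

noncomputable section

namespace Summit.HodgeConjecture.CorCM.HypD3
open scoped TensorProduct Matrix
open NumberField NumberField.InfinitePlace
open Literature.NumberTheory.ComplexMultiplication
open Literature.NumberTheory.Automorphic
open Literature.NumberTheory.Automorphic.IdeleClassGroup (toHeckeCharacter isUnitary_toHeckeCharacter)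
open Literature.NumberTheory.Automorphic.Liu2021
open HodgeCM.Model.ArchSideTerm (e₁)
open Literature.NumberTheory.GelbartRogawski1991 Literature.NumberTheory.GelbartRogawski1991.UnitaryDualPair
open Literature.NumberTheory.GelbartRogawski1991.UnitaryDualPair.LocalSplitting (localMu norm_localMu continuous_localMu
  localMu_toLocalRing_eq_one_iff lineTransportSection conj_lineDelta lineDelta_ne_zero lineDelta_mul_self)
open Literature.RepresentationTheory Literature.RepresentationTheory.Liu2021
open Literature.RepresentationTheory.MoeglinVignerasWaldspurger1987 (lineTransportSplitting)
open Summit.HodgeConjecture.CorCM.Transposition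
open Literature.NumberTheory.Weil1964
open Literature.RepresentationTheory.HarrisKudlaSweet1996 Literature.NumberTheory.GaloisRepresentations

open Literature.NumberTheory.GelbartRogawski1991.GRConstruction (localMu_eq_of_congrW_undoubledSplittings_s_eq_three)
open Literature.NumberTheory.GelbartRogawski1991.UnitaryDualPair.LocalSplitting (lineTransportSection_injective)

-- heartbeats: the spelled `hF8`/`hS6a`/`hK` binders alone exceed the default budget (as in the sibling HypD3 files).
set_option maxHeartbeats 1600000 in
/-- **the place-free residual `LineRigidityS6a` from the per-character line-rigidity identity** (hypothesis `hF8` = B-p13's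
F8b-3 MAIN in the consumers' spelling): instantiate `μ := toHeckeCharacter (ψ i)`, `a₁ := aOf i`, `a₂ := aOf j`.
[cite: Liu2021, App. D Lemma D.1 (3) (l. 5233), proof l. 5255] [cite: MoeglinVignerasWaldspurger1987, Chap. 2 II.1] -/
theorem lineRigidityTransported_of_perCharacter
    (hF8 : ∀ (F : HodgeCM.CMField) (dV : Fin 3 → (F : Type))
      (hdV : ∀ i, IsCMField.complexConj (F : Type) (dV i) = dV i) (hdV0 : ∀ i, dV i ≠ 0)
      (μ : HeckeCharacter (F : Type)) (hμ : IsSplittingChar (F : Type) 1 μ)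
      (a₁ a₂ : (↥(maximalRealSubfield (F : Type)))ˣ)
      (v : IsDedekindDomain.HeightOneSpectrum (𝓞 ↥(maximalRealSubfield (F : Type))))
      (x : (UnitaryGroup.LocalRing (F : Type) v)ˣ) (hx : algebraMap (F : Type) (UnitaryGroup.LocalRing (F : Type) v) (algebraMap ↥(maximalRealSubfield (F : Type)) (F : Type) (↑a₂⁻¹ : ↥(maximalRealSubfield (F : Type))) * imagUnit (F : Type)) =
            (x : (UnitaryGroup.LocalRing (F : Type) v)) * UnitaryGroup.conjLocal (F : Type) (IsCMField.complexConj (F : Type)) v x * algebraMap (F : Type) (UnitaryGroup.LocalRing (F : Type) v) (algebraMap ↥(maximalRealSubfield (F : Type)) (F : Type) (↑a₁⁻¹ : ↥(maximalRealSubfield (F : Type))) * imagUnit (F : Type))),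
          lineTransportSplitting (F : Type) v (IsCMField.complexConj (F : Type)) 3 (conj_lineDelta (complexConj_imagUnit (F : Type)) a₁) (lineDelta_ne_zero (imagUnit_ne_zero (F : Type)) a₁)
            (lineDelta_mul_self (imagUnit_mul_self (F : Type)) a₁) (conj_lineDelta (complexConj_imagUnit (F : Type)) a₂) (lineDelta_ne_zero (imagUnit_ne_zero (F : Type)) a₂)
            (lineDelta_mul_self (imagUnit_mul_self (F : Type)) a₂) x (realDiagonal (F : Type) dV hdV) (realDiagonal_isSymm (F : Type) dV hdV) (isUnit_det_realDiagonal (F : Type) dV hdV hdV0) hx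
            (lineTransportSection ↥(maximalRealSubfield (F : Type)) (F : Type) (IsCMField.complexConj (F : Type)) 3 (complexConj_imagUnit (F : Type)) (imagUnit_ne_zero (F : Type)) (imagUnit_mul_self (F : Type)) (realDiagonal (F : Type) dV hdV) (realDiagonal_isSymm (F : Type) dV hdV) (Matrix.diagonal dV) (realDiagonal_map (F : Type) dV hdV).symm a₁ v ((OmegaChiSplitting.chiLocalSplittingsD ⟨HodgeCM.CMField.K F⟩ e₁ dV hdV hdV0 μ hμ a₁).s v) ((OmegaChiSplitting.chiLocalSplittingsD ⟨HodgeCM.CMField.K F⟩ e₁ dV hdV hdV0 μ hμ a₁).proj_s v)) =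
          (lineTransportSection ↥(maximalRealSubfield (F : Type)) (F : Type) (IsCMField.complexConj (F : Type)) 3 (complexConj_imagUnit (F : Type)) (imagUnit_ne_zero (F : Type)) (imagUnit_mul_self (F : Type)) (realDiagonal (F : Type) dV hdV) (realDiagonal_isSymm (F : Type) dV hdV) (Matrix.diagonal dV) (realDiagonal_map (F : Type) dV hdV).symm a₂ v ((OmegaChiSplitting.chiLocalSplittingsD ⟨HodgeCM.CMField.K F⟩ e₁ dV hdV hdV0 μ hμ a₂).s v) ((OmegaChiSplitting.chiLocalSplittingsD ⟨HodgeCM.CMField.K F⟩ e₁ dV hdV hdV0 μ hμ a₂).proj_s v))) :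
    ∀ (F : HodgeCM.CMField) (dV : Fin 3 → (F : Type))
      (hdV : ∀ i, IsCMField.complexConj (F : Type) (dV i) = dV i) (hdV0 : ∀ i, dV i ≠ 0) {ι : Type}
      (ψ : ι → (Literature.NumberTheory.Automorphic.IdeleClassGroup (F : Type) →ₜ* Circle))
      (hψ : ∀ t, IdeleClassGroup.IsConjugateSymplectic (F : Type) (ψ t))
      (aOf : ι → (↥(maximalRealSubfield (F : Type)))ˣ)
      (v : IsDedekindDomain.HeightOneSpectrum (𝓞 ↥(maximalRealSubfield (F : Type)))),
      ∀ i j : ι,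
        (∀ (x : (UnitaryGroup.LocalRing (F : Type) v)ˣ) (hx : algebraMap (F : Type) (UnitaryGroup.LocalRing (F : Type) v) (algebraMap ↥(maximalRealSubfield (F : Type)) (F : Type) (↑(aOf j)⁻¹ : ↥(maximalRealSubfield (F : Type))) * imagUnit (F : Type)) =
            (x : (UnitaryGroup.LocalRing (F : Type) v)) * UnitaryGroup.conjLocal (F : Type) (IsCMField.complexConj (F : Type)) v x * algebraMap (F : Type) (UnitaryGroup.LocalRing (F : Type) v) (algebraMap ↥(maximalRealSubfield (F : Type)) (F : Type) (↑(aOf i)⁻¹ : ↥(maximalRealSubfield (F : Type))) * imagUnit (F : Type))),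
          lineTransportSplitting (F : Type) v (IsCMField.complexConj (F : Type)) 3 (conj_lineDelta (complexConj_imagUnit (F : Type)) (aOf i)) (lineDelta_ne_zero (imagUnit_ne_zero (F : Type)) (aOf i))
            (lineDelta_mul_self (imagUnit_mul_self (F : Type)) (aOf i)) (conj_lineDelta (complexConj_imagUnit (F : Type)) (aOf j)) (lineDelta_ne_zero (imagUnit_ne_zero (F : Type)) (aOf j))
            (lineDelta_mul_self (imagUnit_mul_self (F : Type)) (aOf j)) x (realDiagonal (F : Type) dV hdV) (realDiagonal_isSymm (F : Type) dV hdV) (isUnit_det_realDiagonal (F : Type) dV hdV hdV0) hx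
            (lineTransportSection ↥(maximalRealSubfield (F : Type)) (F : Type) (IsCMField.complexConj (F : Type)) 3 (complexConj_imagUnit (F : Type)) (imagUnit_ne_zero (F : Type)) (imagUnit_mul_self (F : Type)) (realDiagonal (F : Type) dV hdV) (realDiagonal_isSymm (F : Type) dV hdV) (Matrix.diagonal dV) (realDiagonal_map (F : Type) dV hdV).symm (aOf i) v ((OmegaChiSplitting.chiLocalSplittingsD ⟨HodgeCM.CMField.K F⟩ e₁ dV hdV hdV0 (toHeckeCharacter (F : Type) (ψ i)) ((isOscillatorChar_toHeckeCharacter_iff (ψ i)).mpr (hψ i)) (aOf i)).s v) ((OmegaChiSplitting.chiLocalSplittingsD ⟨HodgeCM.CMField.K F⟩ e₁ dV hdV hdV0 (toHeckeCharacter (F : Type) (ψ i)) ((isOscillatorChar_toHeckeCharacter_iff (ψ i)).mpr (hψ i)) (aOf i)).proj_s v)) =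
          (lineTransportSection ↥(maximalRealSubfield (F : Type)) (F : Type) (IsCMField.complexConj (F : Type)) 3 (complexConj_imagUnit (F : Type)) (imagUnit_ne_zero (F : Type)) (imagUnit_mul_self (F : Type)) (realDiagonal (F : Type) dV hdV) (realDiagonal_isSymm (F : Type) dV hdV) (Matrix.diagonal dV) (realDiagonal_map (F : Type) dV hdV).symm (aOf j) v ((OmegaChiSplitting.chiLocalSplittingsD ⟨HodgeCM.CMField.K F⟩ e₁ dV hdV hdV0 (toHeckeCharacter (F : Type) (ψ i)) ((isOscillatorChar_toHeckeCharacter_iff (ψ i)).mpr (hψ i)) (aOf j)).s v) ((OmegaChiSplitting.chiLocalSplittingsD ⟨HodgeCM.CMField.K F⟩ e₁ dV hdV hdV0 (toHeckeCharacter (F : Type) (ψ i)) ((isOscillatorChar_toHeckeCharacter_iff (ψ i)).mpr (hψ i)) (aOf j)).proj_s v))) := by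
  intro F dV hdV hdV0 ι ψ hψ aOf v i j x hx
  exact hF8 F dV hdV hdV0 (toHeckeCharacter (F : Type) (ψ i)) ((isOscillatorChar_toHeckeCharacter_iff (ψ i)).mpr (hψ i))
    (aOf i) (aOf j) v x hx

set_option maxHeartbeats 1600000 in
/-- **the v2/v3 residual `KudlaTransportedSectionEq` (Kudla's transported injectivity `hK i j`, all members, all places) from
the per-character line-rigidity identity**: `kudla_of_lineRigidity` fed with `lineRigidityTransported_of_perCharacter`.
Conclusion = the skeleton's `KudlaTransportedSectionEq` body byte-for-byte.
[cite: Kudla1994, §3 Thm. 3.1] [cite: Liu2021, App. D Lemma D.1 (3) (l. 5233), proof l. 5255] -/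
theorem kudlaTransportedSectionEq_of_perCharacter
    (hF8 : ∀ (F : HodgeCM.CMField) (dV : Fin 3 → (F : Type))
      (hdV : ∀ i, IsCMField.complexConj (F : Type) (dV i) = dV i) (hdV0 : ∀ i, dV i ≠ 0)
      (μ : HeckeCharacter (F : Type)) (hμ : IsSplittingChar (F : Type) 1 μ)
      (a₁ a₂ : (↥(maximalRealSubfield (F : Type)))ˣ)
      (v : IsDedekindDomain.HeightOneSpectrum (𝓞 ↥(maximalRealSubfield (F : Type))))
      (x : (UnitaryGroup.LocalRing (F : Type) v)ˣ) (hx : algebraMap (F : Type) (UnitaryGroup.LocalRing (F : Type) v) (algebraMap ↥(maximalRealSubfield (F : Type)) (F : Type) (↑a₂⁻¹ : ↥(maximalRealSubfield (F : Type))) * imagUnit (F : Type)) =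
            (x : (UnitaryGroup.LocalRing (F : Type) v)) * UnitaryGroup.conjLocal (F : Type) (IsCMField.complexConj (F : Type)) v x * algebraMap (F : Type) (UnitaryGroup.LocalRing (F : Type) v) (algebraMap ↥(maximalRealSubfield (F : Type)) (F : Type) (↑a₁⁻¹ : ↥(maximalRealSubfield (F : Type))) * imagUnit (F : Type))),
          lineTransportSplitting (F : Type) v (IsCMField.complexConj (F : Type)) 3 (conj_lineDelta (complexConj_imagUnit (F : Type)) a₁) (lineDelta_ne_zero (imagUnit_ne_zero (F : Type)) a₁)
            (lineDelta_mul_self (imagUnit_mul_self (F : Type)) a₁) (conj_lineDelta (complexConj_imagUnit (F : Type)) a₂) (lineDelta_ne_zero (imagUnit_ne_zero (F : Type)) a₂)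
            (lineDelta_mul_self (imagUnit_mul_self (F : Type)) a₂) x (realDiagonal (F : Type) dV hdV) (realDiagonal_isSymm (F : Type) dV hdV) (isUnit_det_realDiagonal (F : Type) dV hdV hdV0) hx
            (lineTransportSection ↥(maximalRealSubfield (F : Type)) (F : Type) (IsCMField.complexConj (F : Type)) 3 (complexConj_imagUnit (F : Type)) (imagUnit_ne_zero (F : Type)) (imagUnit_mul_self (F : Type)) (realDiagonal (F : Type) dV hdV) (realDiagonal_isSymm (F : Type) dV hdV) (Matrix.diagonal dV) (realDiagonal_map (F : Type) dV hdV).symm a₁ v ((OmegaChiSplitting.chiLocalSplittingsD ⟨HodgeCM.CMField.K F⟩ e₁ dV hdV hdV0 μ hμ a₁).s v) ((OmegaChiSplitting.chiLocalSplittingsD ⟨HodgeCM.CMField.K F⟩ e₁ dV hdV hdV0 μ hμ a₁).proj_s v)) =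
          (lineTransportSection ↥(maximalRealSubfield (F : Type)) (F : Type) (IsCMField.complexConj (F : Type)) 3 (complexConj_imagUnit (F : Type)) (imagUnit_ne_zero (F : Type)) (imagUnit_mul_self (F : Type)) (realDiagonal (F : Type) dV hdV) (realDiagonal_isSymm (F : Type) dV hdV) (Matrix.diagonal dV) (realDiagonal_map (F : Type) dV hdV).symm a₂ v ((OmegaChiSplitting.chiLocalSplittingsD ⟨HodgeCM.CMField.K F⟩ e₁ dV hdV hdV0 μ hμ a₂).s v) ((OmegaChiSplitting.chiLocalSplittingsD ⟨HodgeCM.CMField.K F⟩ e₁ dV hdV hdV0 μ hμ a₂).proj_s v))) :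
    ∀ (F : HodgeCM.CMField) (dV : Fin 3 → (F : Type))
      (hdV : ∀ i, IsCMField.complexConj (F : Type) (dV i) = dV i) (hdV0 : ∀ i, dV i ≠ 0) {ι : Type}
      (ψ : ι → (Literature.NumberTheory.Automorphic.IdeleClassGroup (F : Type) →ₜ* Circle))
      (hψ : ∀ t, IdeleClassGroup.IsConjugateSymplectic (F : Type) (ψ t))
      (aOf : ι → (↥(maximalRealSubfield (F : Type)))ˣ)
      (χOf : ι → Def411WeilCarriers.Chi ↥(maximalRealSubfield (F : Type)) (F : Type) (IsCMField.complexConj (F : Type)))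
      (v : IsDedekindDomain.HeightOneSpectrum (𝓞 ↥(maximalRealSubfield (F : Type)))),
      ∀ i j : ι,
        (∃ (x : (UnitaryGroup.LocalRing (F : Type) v)ˣ) (hx : algebraMap (F : Type) (UnitaryGroup.LocalRing (F : Type) v) (algebraMap ↥(maximalRealSubfield (F : Type)) (F : Type) (↑(aOf j)⁻¹ : ↥(maximalRealSubfield (F : Type))) * imagUnit (F : Type)) =
            (x : (UnitaryGroup.LocalRing (F : Type) v)) * UnitaryGroup.conjLocal (F : Type) (IsCMField.complexConj (F : Type)) v x * algebraMap (F : Type) (UnitaryGroup.LocalRing (F : Type) v) (algebraMap ↥(maximalRealSubfield (F : Type)) (F : Type) (↑(aOf i)⁻¹ : ↥(maximalRealSubfield (F : Type))) * imagUnit (F : Type))),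
          lineTransportSplitting (F : Type) v (IsCMField.complexConj (F : Type)) 3 (conj_lineDelta (complexConj_imagUnit (F : Type)) (aOf i)) (lineDelta_ne_zero (imagUnit_ne_zero (F : Type)) (aOf i))
            (lineDelta_mul_self (imagUnit_mul_self (F : Type)) (aOf i)) (conj_lineDelta (complexConj_imagUnit (F : Type)) (aOf j)) (lineDelta_ne_zero (imagUnit_ne_zero (F : Type)) (aOf j))
            (lineDelta_mul_self (imagUnit_mul_self (F : Type)) (aOf j)) x (realDiagonal (F : Type) dV hdV) (realDiagonal_isSymm (F : Type) dV hdV) (isUnit_det_realDiagonal (F : Type) dV hdV hdV0) hx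
            (lineTransportSection ↥(maximalRealSubfield (F : Type)) (F : Type) (IsCMField.complexConj (F : Type)) 3 (complexConj_imagUnit (F : Type)) (imagUnit_ne_zero (F : Type)) (imagUnit_mul_self (F : Type)) (realDiagonal (F : Type) dV hdV) (realDiagonal_isSymm (F : Type) dV hdV) (Matrix.diagonal dV) (realDiagonal_map (F : Type) dV hdV).symm (aOf i) v ((OmegaChiSplitting.chiLocalSplittingsD ⟨HodgeCM.CMField.K F⟩ e₁ dV hdV hdV0 (toHeckeCharacter (F : Type) (ψ i)) ((isOscillatorChar_toHeckeCharacter_iff (ψ i)).mpr (hψ i)) (aOf i)).s v) ((OmegaChiSplitting.chiLocalSplittingsD ⟨HodgeCM.CMField.K F⟩ e₁ dV hdV hdV0 (toHeckeCharacter (F : Type) (ψ i)) ((isOscillatorChar_toHeckeCharacter_iff (ψ i)).mpr (hψ i)) (aOf i)).proj_s v)) =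
          (lineTransportSection ↥(maximalRealSubfield (F : Type)) (F : Type) (IsCMField.complexConj (F : Type)) 3 (complexConj_imagUnit (F : Type)) (imagUnit_ne_zero (F : Type)) (imagUnit_mul_self (F : Type)) (realDiagonal (F : Type) dV hdV) (realDiagonal_isSymm (F : Type) dV hdV) (Matrix.diagonal dV) (realDiagonal_map (F : Type) dV hdV).symm (aOf j) v ((OmegaChiSplitting.chiLocalSplittingsD ⟨HodgeCM.CMField.K F⟩ e₁ dV hdV hdV0 (toHeckeCharacter (F : Type) (ψ j)) ((isOscillatorChar_toHeckeCharacter_iff (ψ j)).mpr (hψ j)) (aOf j)).s v) ((OmegaChiSplitting.chiLocalSplittingsD ⟨HodgeCM.CMField.K F⟩ e₁ dV hdV hdV0 (toHeckeCharacter (F : Type) (ψ j)) ((isOscillatorChar_toHeckeCharacter_iff (ψ j)).mpr (hψ j)) (aOf j)).proj_s v))) →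
        localMu (F : Type) (toHeckeCharacter (F : Type) (ψ j)) v = localMu (F : Type) (toHeckeCharacter (F : Type) (ψ i)) v := by
  intro F dV hdV hdV0 ι ψ hψ aOf χOf v i j
  exact kudla_of_lineRigidity F dV hdV hdV0 ψ hψ aOf v i j
    (lineRigidityTransported_of_perCharacter hF8 F dV hdV hdV0 ψ hψ aOf v i j)

end Summit.HodgeConjecture.CorCM.HypD3

end
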